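import Mathlib
import HarnessLib
import Literature.Analysis.FluidPDE.VorticityEquation
import Literature.Analysis.FluidPDE.NSLocalLerayBackwardUniqueness
import Literature.Analysis.FluidPDE.TsaiMaximumPrinciple
import Literature.Analysis.FluidPDE.BarkerPrange2020VorticityAlignmentTypeIHolds
import Summits.NavierStokesRegularity.NavierStokesRegularity.Theorems.PoloidalWindowDoorPoloidalWindowRigidityWindow
import Summits.NavierStokesRegularity.NavierStokesRegularity.Theorems.AxisTwistDoorTiltDominationLocEnergyClass

/-!
# AxisTwistDoor · crux `TiltDominationLoc` (stmt-NavierStokesRegularity-26991) — CONTACT POINTS of a one-signed profile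
# (what the sign `ω₃ ≥ 0` forces at a zero of `ω₃`: the LocalDatum letters of the C5 verdict, as kernel theorems)

Crux 26991 in core form (`…EnergyClass.oneSignedRigidity_iff_core`): no Type-I ancient Oseen-mild profile with
`ω₃ = ⟪curl v, e₃⟫ ≥ 0` on the backward slab is backward-singular at the apex.  A CONTACT POINT of such a profile is a
point `(s₀, y₀)` of the open slab with `ω₃(s₀, y₀) = 0` — an interior space–time minimum of the non-negative,
jointly real-analytic function `ω₃`.  This file records what the sign and the vorticity equation force there (the
«gauge letters + Hessian sign» of the cell ns-wall-extremal's one-signed jet format, cf. the W3 LEAD's C5 verdict on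
item 26991, R2), every clause elementary:

* `fderiv_omega3_eq_zero_at_contact`, `hasDerivAt_omega3_zero_at_contact` — Fermat in space and in time:
  `∇ₓω₃(s₀, y₀) = 0`, `∂ₜω₃(s₀, y₀) = 0`;
* `laplacian_omega3_nonneg_at_contact` — second-order condition: `Δₓω₃(s₀, y₀) ≥ 0`;
* `vertical_stretching_eq_neg_laplacian_at_contact` — the third component of the vorticity equation
  `∂ₜω + (v·∇)ω = (ω·∇)v + Δω` at a contact point reads `⟪(∇v) ω, e₃⟫ = −Δω₃` (the transport terms vanish by Fermat);
* `vertical_stretching_nonpos_at_contact` — hence **the vertical vortex stretching is non-positive at every contact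
  point**: `⟪(∇v(s₀,y₀)) ω(s₀,y₀), e₃⟫ = ω₁∂₁v₃ + ω₂∂₂v₃ ≤ 0` (as `ω₃ = 0` there).  The horizontal vorticity at a
  contact point cannot be tilted «upward» by the strain to first order — the only local INEQUALITY the one-signed class
  adds to the Navier–Stokes jet system at such a point (C5 verdict R2);
* `contactPoint_portrait` — the package.

The open-set version (a whole poloidal slice: `= 0` instead of `≤ 0`, the slice is (TH)) is
`…AxisTwistDoorTiltDominationLocPoloidalSlice`.  WHAT THIS IS NOT: contact points need not exist (ω₃ > 0 everywhere is
consistent with everything in the tree); nothing here proves 26991, W4, W6, the leaf or any Navier–Stokes regularity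
statement (Clay A OPEN).  Seat ns-atd-p1 (LEAD g4).  [cite: MajdaBertozzi2002, §1.4 eq. (1.33) (vorticity equation);
GilbargTrudinger2001, §3.1 (second-order condition at an extremum); LemarieRieusset2016, Thm. 9.12 (analyticity)]
-/

noncomputable section

-- the summit and its single sub-problem share the name (CONVENTIONS §1), as in every Theorems file
set_option linter.dupNamespace false

namespace Summit.NavierStokesRegularity.NavierStokesRegularity.Theorems.AxisTwistDoorTiltDominationLocContactPoints

open Set Function Filter Topology MeasureTheory Metric
open scoped ENNReal InnerProductSpace
open Literature.Analysis Literature.Analysis.FluidPDE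
open Summit.NavierStokesRegularity.NavierStokesRegularity.Theorems.PoloidalWindowDoorPoloidalWindowRigidityWindow
  (isTypeIAncientMild_of_class)
open Summit.NavierStokesRegularity.NavierStokesRegularity.Theorems.AxisTwistDoorTiltDominationLocRigidity
  (analyticOnNhd_omega3)

variable {C : ℝ} {v : ℝ → EuclideanSpace ℝ (Fin 3) → EuclideanSpace ℝ (Fin 3)}

/-! ### §0 Plumbing: slices and time lines of the jointly analytic `ω₃` -/

/-- Slices of a jointly analytic function on the open backward slab are analytic (plumbing). -/
private theorem analyticAt_slice_of_joint {X : Type*} [NormedAddCommGroup X] [NormedSpace ℝ X]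
    {F : ℝ × EuclideanSpace ℝ (Fin 3) → X} (hF : AnalyticOnNhd ℝ F (Iio (0 : ℝ) ×ˢ univ))
    {s₀ : ℝ} (hs₀ : s₀ < 0) (y : EuclideanSpace ℝ (Fin 3)) :
    AnalyticAt ℝ (fun z : EuclideanSpace ℝ (Fin 3) => F (s₀, z)) y :=
  AnalyticAt.comp₂ (h := F) (f := fun _ : EuclideanSpace ℝ (Fin 3) => s₀) (g := fun z : EuclideanSpace ℝ (Fin 3) => z)
    (hF (s₀, y) ⟨hs₀, mem_univ _⟩) analyticAt_const analyticAt_id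

/-- Time lines of a jointly analytic function on the open backward slab are analytic at interior times (plumbing). -/
private theorem analyticAt_line_of_joint {X : Type*} [NormedAddCommGroup X] [NormedSpace ℝ X]
    {F : ℝ × EuclideanSpace ℝ (Fin 3) → X} (hF : AnalyticOnNhd ℝ F (Iio (0 : ℝ) ×ˢ univ))
    {s₀ : ℝ} (hs₀ : s₀ < 0) (y : EuclideanSpace ℝ (Fin 3)) :
    AnalyticAt ℝ (fun t : ℝ => F (t, y)) s₀ :=
  AnalyticAt.comp₂ (h := F) (f := fun t : ℝ => t) (g := fun _ : ℝ => y)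
    (hF (s₀, y) ⟨hs₀, mem_univ _⟩) analyticAt_id analyticAt_const

/-- The slice `y ↦ ω₃(s₀, y)` of a class profile is `C²` (indeed real-analytic) on `ℝ³`. -/
theorem contDiff_omega3_slice (hrate : HasTypeITimeDecay C v)
    (hcont : ContinuousOn (uncurry v) (Iio (0 : ℝ) ×ˢ univ))
    (hmild : ∀ s t : ℝ, s < t → t < 0 → ∀ x,
      v t x = UnboundedOperators.heatExtension (v s) (t - s) x - oseenDuhamel 1 s v v t x)
    {s₀ : ℝ} (hs₀ : s₀ < 0) :
    ContDiff ℝ 2 (fun y : EuclideanSpace ℝ (Fin 3) =>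
      ⟪curl (v s₀) y, (EuclideanSpace.single (2 : Fin 3) (1 : ℝ))⟫_ℝ) := by
  have hF := analyticOnNhd_omega3 hrate hcont hmild
  have hslice : AnalyticOnNhd ℝ (fun y : EuclideanSpace ℝ (Fin 3) =>
      ⟪curl (v s₀) y, (EuclideanSpace.single (2 : Fin 3) (1 : ℝ))⟫_ℝ) univ :=
    fun y _ => analyticAt_slice_of_joint hF hs₀ y
  exact hslice.contDiff

/-! ### §1 Fermat at a contact point: first derivatives of `ω₃` vanish, in space and in time -/

/-- **Spatial Fermat at a contact point** (SIGN): if `ω₃ ≥ 0` on the slab and `ω₃(s₀, y₀) = 0`, then the spatial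
derivative of the slice `ω₃(s₀, ·)` vanishes at `y₀`. [cite: GilbargTrudinger2001, §3.1] -/
theorem fderiv_omega3_eq_zero_at_contact
    (hnn : ∀ s < (0 : ℝ), ∀ y, 0 ≤ ⟪curl (v s) y, (EuclideanSpace.single (2 : Fin 3) (1 : ℝ))⟫_ℝ)
    {s₀ : ℝ} (hs₀ : s₀ < 0) {y₀ : EuclideanSpace ℝ (Fin 3)}
    (h0 : ⟪curl (v s₀) y₀, (EuclideanSpace.single (2 : Fin 3) (1 : ℝ))⟫_ℝ = 0) :
    fderiv ℝ (fun y : EuclideanSpace ℝ (Fin 3) =>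
      ⟪curl (v s₀) y, (EuclideanSpace.single (2 : Fin 3) (1 : ℝ))⟫_ℝ) y₀ = 0 := by
  have hmin : IsLocalMin (fun y : EuclideanSpace ℝ (Fin 3) =>
      ⟪curl (v s₀) y, (EuclideanSpace.single (2 : Fin 3) (1 : ℝ))⟫_ℝ) y₀ :=
    Eventually.of_forall fun y => by
      show ⟪curl (v s₀) y₀, (EuclideanSpace.single (2 : Fin 3) (1 : ℝ))⟫_ℝ ≤
        ⟪curl (v s₀) y, (EuclideanSpace.single (2 : Fin 3) (1 : ℝ))⟫_ℝ
      rw [h0]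
      exact hnn s₀ hs₀ y
  exact hmin.fderiv_eq_zero

/-- **Temporal Fermat at a contact point** (SIGN): if `ω₃ ≥ 0` on the slab and `ω₃(s₀, y₀) = 0` with `s₀ < 0`, the
time line `t ↦ ω₃(t, y₀)` (differentiable at `s₀` by joint analyticity) has derivative `0` at `s₀`. [cite:
LemarieRieusset2016, Thm. 9.12 (analyticity, for differentiability in time)] -/
theorem hasDerivAt_omega3_zero_at_contact (hrate : HasTypeITimeDecay C v)
    (hcont : ContinuousOn (uncurry v) (Iio (0 : ℝ) ×ˢ univ))
    (hmild : ∀ s t : ℝ, s < t → t < 0 → ∀ x,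
      v t x = UnboundedOperators.heatExtension (v s) (t - s) x - oseenDuhamel 1 s v v t x)
    (hnn : ∀ s < (0 : ℝ), ∀ y, 0 ≤ ⟪curl (v s) y, (EuclideanSpace.single (2 : Fin 3) (1 : ℝ))⟫_ℝ)
    {s₀ : ℝ} (hs₀ : s₀ < 0) {y₀ : EuclideanSpace ℝ (Fin 3)}
    (h0 : ⟪curl (v s₀) y₀, (EuclideanSpace.single (2 : Fin 3) (1 : ℝ))⟫_ℝ = 0) :
    HasDerivAt (fun t : ℝ => ⟪curl (v t) y₀, (EuclideanSpace.single (2 : Fin 3) (1 : ℝ))⟫_ℝ) 0 s₀ := by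
  have hF := analyticOnNhd_omega3 hrate hcont hmild
  have hd : HasDerivAt (fun t : ℝ => ⟪curl (v t) y₀, (EuclideanSpace.single (2 : Fin 3) (1 : ℝ))⟫_ℝ)
      (deriv (fun t : ℝ => ⟪curl (v t) y₀, (EuclideanSpace.single (2 : Fin 3) (1 : ℝ))⟫_ℝ) s₀) s₀ :=
    (analyticAt_line_of_joint hF hs₀ y₀).differentiableAt.hasDerivAt
  have hmin : IsLocalMin (fun t : ℝ => ⟪curl (v t) y₀, (EuclideanSpace.single (2 : Fin 3) (1 : ℝ))⟫_ℝ) s₀ := by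
    filter_upwards [Iio_mem_nhds hs₀] with t ht
    rw [h0]
    exact hnn t ht y₀
  have h := hmin.hasDerivAt_eq_zero hd
  rwa [h] at hd

/-! ### §2 Second order: `Δω₃ ≥ 0` at a contact point -/

/-- **Second-order condition at a contact point** (SIGN): if `ω₃ ≥ 0` on the slab and `ω₃(s₀, y₀) = 0`, then the
Laplacian of the slice `ω₃(s₀, ·)` is non-negative at `y₀` (a local minimum of a `C²` function; the tree's
`laplacian_nonpos_of_isLocalMax` applied to `−ω₃`). [cite: GilbargTrudinger2001, §3.1] -/
theorem laplacian_omega3_nonneg_at_contact (hrate : HasTypeITimeDecay C v)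
    (hcont : ContinuousOn (uncurry v) (Iio (0 : ℝ) ×ˢ univ))
    (hmild : ∀ s t : ℝ, s < t → t < 0 → ∀ x,
      v t x = UnboundedOperators.heatExtension (v s) (t - s) x - oseenDuhamel 1 s v v t x)
    (hnn : ∀ s < (0 : ℝ), ∀ y, 0 ≤ ⟪curl (v s) y, (EuclideanSpace.single (2 : Fin 3) (1 : ℝ))⟫_ℝ)
    {s₀ : ℝ} (hs₀ : s₀ < 0) {y₀ : EuclideanSpace ℝ (Fin 3)}
    (h0 : ⟪curl (v s₀) y₀, (EuclideanSpace.single (2 : Fin 3) (1 : ℝ))⟫_ℝ = 0) :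
    0 ≤ Laplacian.laplacian (fun y : EuclideanSpace ℝ (Fin 3) =>
      ⟪curl (v s₀) y, (EuclideanSpace.single (2 : Fin 3) (1 : ℝ))⟫_ℝ) y₀ := by
  set f : EuclideanSpace ℝ (Fin 3) → ℝ := fun y =>
    ⟪curl (v s₀) y, (EuclideanSpace.single (2 : Fin 3) (1 : ℝ))⟫_ℝ with hf
  have hf2 : ContDiff ℝ 2 f := contDiff_omega3_slice hrate hcont hmild hs₀
  have hmax : IsLocalMax (-f) y₀ :=
    Eventually.of_forall fun y => by
      show -f y ≤ -f y₀
      rw [hf]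
      dsimp only
      rw [h0, neg_zero, neg_nonpos]
      exact hnn s₀ hs₀ y
  have h := laplacian_nonpos_of_isLocalMax hf2.neg hmax
  have hneg : Laplacian.laplacian (-f) = -Laplacian.laplacian f := InnerProductSpace.laplacian_neg
  have h' : Laplacian.laplacian (-f) y₀ ≤ 0 := h
  rw [hneg, Pi.neg_apply, neg_nonpos] at h'
  exact h'

/-! ### §3 The vorticity equation at a contact point -/

/-- **Vertical stretching = −Δω₃ at a contact point.**  For a class profile with `ω₃ ≥ 0` on the slab and a contact
point `ω₃(s₀, y₀) = 0`, `s₀ < 0`: `⟪(fderiv ℝ (v s₀) y₀) (curl v(s₀) y₀), e₃⟫ = −Δ(ω₃(s₀,·))(y₀)`.  Third component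
of `∂ₜω + (v·∇)ω = (ω·∇)v + Δω` (classical on `(−∞,0)`: `exists_classical_of_class`,
`isVorticitySolutionOn_zero_force`), with `∂ₜω₃ = 0` and `∇ₓω₃ = 0` at the contact point (§1). [cite:
MajdaBertozzi2002, §1.4 eq. (1.33) and Prop. 2.21 (vorticity equation)] -/
theorem vertical_stretching_eq_neg_laplacian_at_contact (hrate : HasTypeITimeDecay C v)
    (hcont : ContinuousOn (uncurry v) (Iio (0 : ℝ) ×ˢ univ))
    (hmild : ∀ s t : ℝ, s < t → t < 0 → ∀ x,
      v t x = UnboundedOperators.heatExtension (v s) (t - s) x - oseenDuhamel 1 s v v t x)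
    (hdiv : ∀ t < 0, VectorCalculus.IsDivFree (v t))
    (hnn : ∀ s < (0 : ℝ), ∀ y, 0 ≤ ⟪curl (v s) y, (EuclideanSpace.single (2 : Fin 3) (1 : ℝ))⟫_ℝ)
    {s₀ : ℝ} (hs₀ : s₀ < 0) {y₀ : EuclideanSpace ℝ (Fin 3)}
    (h0 : ⟪curl (v s₀) y₀, (EuclideanSpace.single (2 : Fin 3) (1 : ℝ))⟫_ℝ = 0) :
    ⟪(fderiv ℝ (v s₀) y₀) (curl (v s₀) y₀), (EuclideanSpace.single (2 : Fin 3) (1 : ℝ))⟫_ℝ =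
      -Laplacian.laplacian (fun y : EuclideanSpace ℝ (Fin 3) =>
        ⟪curl (v s₀) y, (EuclideanSpace.single (2 : Fin 3) (1 : ℝ))⟫_ℝ) y₀ := by
  set e : EuclideanSpace ℝ (Fin 3) := EuclideanSpace.single (2 : Fin 3) (1 : ℝ) with he
  set L : EuclideanSpace ℝ (Fin 3) →L[ℝ] ℝ := innerSL ℝ e with hL
  have hLapp : ∀ w : EuclideanSpace ℝ (Fin 3), L w = ⟪w, e⟫_ℝ := fun w => by
    rw [hL, innerSL_apply_apply, real_inner_comm]
  have hLfun : (⇑L ∘ curl (v s₀)) = fun y => ⟪curl (v s₀) y, e⟫_ℝ := funext fun y => hLapp _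
  have hU := isTypeIAncientMild_of_class hrate hcont hmild hdiv
  -- the vorticity equation at `(s₀, y₀)`
  obtain ⟨q, hcl⟩ := ChiralWindowDoorClassDerivDecay.exists_classical_of_class hrate hcont hmild hdiv
  have hvort := hcl.isVorticitySolutionOn_zero_force (uniqueDiffOn_Iio 0)
    (by rw [interior_Iio]; exact subset_closure)
  have heq := hvort.vorticity_eq s₀ hs₀ y₀
  simp only [vorticity_apply, one_smul] at heq
  -- (i) the time-derivative term pairs to `0` with `e₃`
  have hline := hasDerivAt_omega3_zero_at_contact hrate hcont hmild hnn hs₀ h0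
  have hFω : AnalyticOnNhd ℝ (uncurry fun t x => curl (v t) x) (Iio (0 : ℝ) ×ˢ univ) :=
    TubeAlternative.AnalyticPropagation.analyticOnNhd_uncurry_curl
      (LocalSineTubeDoorProfileAlignedWindowRigidityAncient.analyticOnNhd_uncurry hcont
        (LocalSineTubeDoorProfileAlignedWindowRigidityAncient.bdd_of_hasTypeITimeDecay hrate) hmild) isOpen_Iio
  have hgline : DifferentiableAt ℝ (fun t : ℝ => curl (v t) y₀) s₀ :=
    (analyticAt_line_of_joint hFω hs₀ y₀).differentiableAt
  have h1 : ⟪timeDerivWithin (Iio (0 : ℝ)) (vorticity v) s₀ y₀, e⟫_ℝ = 0 := by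
    rw [timeDerivWithin_apply, derivWithin_of_isOpen isOpen_Iio hs₀]
    show ⟪deriv (fun t : ℝ => curl (v t) y₀) s₀, e⟫_ℝ = 0
    have hcomp : HasDerivAt (fun t : ℝ => L (curl (v t) y₀)) (L (deriv (fun t : ℝ => curl (v t) y₀) s₀)) s₀ :=
      L.hasFDerivAt.comp_hasDerivAt s₀ hgline.hasDerivAt
    have hfun : (fun t : ℝ => L (curl (v t) y₀)) = fun t : ℝ => ⟪curl (v t) y₀, e⟫_ℝ := funext fun t => hLapp _
    rw [hfun] at hcomp
    rw [← hLapp, ← hcomp.unique hline]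
  -- (ii) the convection term `(v·∇)ω` pairs to `0` with `e₃` (spatial Fermat)
  have hcurl_an : AnalyticOnNhd ℝ (curl (v s₀)) univ := analyticOnNhd_curl (hU.analyticOnNhd_slice_univ hs₀)
  have hcurl_diff : DifferentiableAt ℝ (curl (v s₀)) y₀ := (hcurl_an y₀ (mem_univ y₀)).differentiableAt
  have h2 : ⟪convect (v s₀) (curl (v s₀)) y₀, e⟫_ℝ = 0 := by
    rw [convect_apply, ← hLapp]
    have hcomp : HasFDerivAt (⇑L ∘ curl (v s₀)) (L.comp (fderiv ℝ (curl (v s₀)) y₀)) y₀ :=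
      L.hasFDerivAt.comp y₀ hcurl_diff.hasFDerivAt
    rw [hLfun] at hcomp
    have hfd := fderiv_omega3_eq_zero_at_contact hnn hs₀ h0
    have huniq : L.comp (fderiv ℝ (curl (v s₀)) y₀) = 0 := by
      rw [← hcomp.fderiv, hfd]
    have := congrArg (fun φ : EuclideanSpace ℝ (Fin 3) →L[ℝ] ℝ => φ (v s₀ y₀)) huniq
    simpa using this
  -- (iii) the Laplacian term pairs with `e₃` to the Laplacian of the slice `ω₃(s₀, ·)`
  have h3 : ⟪Laplacian.laplacian (curl (v s₀)) y₀, e⟫_ℝ =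
      Laplacian.laplacian (fun y : EuclideanSpace ℝ (Fin 3) => ⟪curl (v s₀) y, e⟫_ℝ) y₀ := by
    rw [← hLapp, ← hLfun]
    have hc2 : ContDiffAt ℝ 2 (curl (v s₀)) y₀ := (hcurl_an y₀ (mem_univ y₀)).contDiffAt
    have key := hc2.laplacian_CLM_comp_left (l := L)
    simpa using key.symm
  -- assemble
  have hpair := congrArg (fun w : EuclideanSpace ℝ (Fin 3) => ⟪w, e⟫_ℝ) heq
  simp only [inner_add_left] at hpair
  rw [h1, h2, h3, zero_add, convect_apply] at hpair
  -- `hpair : 0 = ⟪(∇v) ω, e⟫ + Δ(ω₃ slice)(y₀)`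
  linarith

/-- **Non-positive vertical vortex stretching at every contact point** (SIGN): for a class profile with `ω₃ ≥ 0` on
the slab, at every point `(s₀, y₀)` of the open slab where `ω₃` vanishes,
`⟪(∇v(s₀,y₀)) ω(s₀,y₀), e₃⟫ = ω₁∂₁v₃ + ω₂∂₂v₃ ≤ 0`. [cite: MajdaBertozzi2002, §1.4 eq. (1.33); GilbargTrudinger2001,
§3.1] -/
theorem vertical_stretching_nonpos_at_contact (hrate : HasTypeITimeDecay C v)
    (hcont : ContinuousOn (uncurry v) (Iio (0 : ℝ) ×ˢ univ))
    (hmild : ∀ s t : ℝ, s < t → t < 0 → ∀ x,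
      v t x = UnboundedOperators.heatExtension (v s) (t - s) x - oseenDuhamel 1 s v v t x)
    (hdiv : ∀ t < 0, VectorCalculus.IsDivFree (v t))
    (hnn : ∀ s < (0 : ℝ), ∀ y, 0 ≤ ⟪curl (v s) y, (EuclideanSpace.single (2 : Fin 3) (1 : ℝ))⟫_ℝ)
    {s₀ : ℝ} (hs₀ : s₀ < 0) {y₀ : EuclideanSpace ℝ (Fin 3)}
    (h0 : ⟪curl (v s₀) y₀, (EuclideanSpace.single (2 : Fin 3) (1 : ℝ))⟫_ℝ = 0) :
    ⟪(fderiv ℝ (v s₀) y₀) (curl (v s₀) y₀), (EuclideanSpace.single (2 : Fin 3) (1 : ℝ))⟫_ℝ ≤ 0 := by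
  rw [vertical_stretching_eq_neg_laplacian_at_contact hrate hcont hmild hdiv hnn hs₀ h0, neg_nonpos]
  exact laplacian_omega3_nonneg_at_contact hrate hcont hmild hnn hs₀ h0

/-! ### §4 Package: the local portrait of the one-signed counterexample at a contact point -/

/-- **PORTRAIT AT A CONTACT POINT.**  For a profile of the route's class with `ω₃ ≥ 0` on the backward slab, at every
zero `(s₀, y₀)` of `ω₃` in the open slab: (a) `∇ₓω₃ = 0`, (b) `∂ₜω₃ = 0`, (c) `Δₓω₃ ≥ 0`, (d) `⟪(∇v) ω, e₃⟫ = −Δₓω₃`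
and (e) `⟪(∇v) ω, e₃⟫ ≤ 0`.  These are the only pointwise constraints the sign adds to the Navier–Stokes jet at such a
point (inequalities, no identities — C5 verdict R2); contact points need not exist. [cite: MajdaBertozzi2002, §1.4
eq. (1.33); GilbargTrudinger2001, §3.1] -/
theorem contactPoint_portrait (hrate : HasTypeITimeDecay C v)
    (hcont : ContinuousOn (uncurry v) (Iio (0 : ℝ) ×ˢ univ))
    (hmild : ∀ s t : ℝ, s < t → t < 0 → ∀ x,
      v t x = UnboundedOperators.heatExtension (v s) (t - s) x - oseenDuhamel 1 s v v t x)
    (hdiv : ∀ t < 0, VectorCalculus.IsDivFree (v t))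
    (hnn : ∀ s < (0 : ℝ), ∀ y, 0 ≤ ⟪curl (v s) y, (EuclideanSpace.single (2 : Fin 3) (1 : ℝ))⟫_ℝ)
    {s₀ : ℝ} (hs₀ : s₀ < 0) {y₀ : EuclideanSpace ℝ (Fin 3)}
    (h0 : ⟪curl (v s₀) y₀, (EuclideanSpace.single (2 : Fin 3) (1 : ℝ))⟫_ℝ = 0) :
    fderiv ℝ (fun y : EuclideanSpace ℝ (Fin 3) =>
        ⟪curl (v s₀) y, (EuclideanSpace.single (2 : Fin 3) (1 : ℝ))⟫_ℝ) y₀ = 0 ∧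
      HasDerivAt (fun t : ℝ => ⟪curl (v t) y₀, (EuclideanSpace.single (2 : Fin 3) (1 : ℝ))⟫_ℝ) 0 s₀ ∧
      0 ≤ Laplacian.laplacian (fun y : EuclideanSpace ℝ (Fin 3) =>
        ⟪curl (v s₀) y, (EuclideanSpace.single (2 : Fin 3) (1 : ℝ))⟫_ℝ) y₀ ∧
      ⟪(fderiv ℝ (v s₀) y₀) (curl (v s₀) y₀), (EuclideanSpace.single (2 : Fin 3) (1 : ℝ))⟫_ℝ =
        -Laplacian.laplacian (fun y : EuclideanSpace ℝ (Fin 3) =>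
          ⟪curl (v s₀) y, (EuclideanSpace.single (2 : Fin 3) (1 : ℝ))⟫_ℝ) y₀ ∧
      ⟪(fderiv ℝ (v s₀) y₀) (curl (v s₀) y₀), (EuclideanSpace.single (2 : Fin 3) (1 : ℝ))⟫_ℝ ≤ 0 :=
  ⟨fderiv_omega3_eq_zero_at_contact hnn hs₀ h0,
    hasDerivAt_omega3_zero_at_contact hrate hcont hmild hnn hs₀ h0,
    laplacian_omega3_nonneg_at_contact hrate hcont hmild hnn hs₀ h0,
    vertical_stretching_eq_neg_laplacian_at_contact hrate hcont hmild hdiv hnn hs₀ h0,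
    vertical_stretching_nonpos_at_contact hrate hcont hmild hdiv hnn hs₀ h0⟩

end Summit.NavierStokesRegularity.NavierStokesRegularity.Theorems.AxisTwistDoorTiltDominationLocContactPoints

end
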